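import Summits.NavierStokesRegularity.OSWSelfSimilar.SheetRCertifiedProfileOfRecord
import Summits.NavierStokesRegularity.OSWSelfSimilar.SheetRFrameCentreVelocity
import Summits.NavierStokesRegularity.OSWSelfSimilar.SheetRFrameCentreResidual
import Literature.Analysis.SpecialFunctions.PerturbedChebyshevRecurrence
import HarnessLib

/-!
# SHEET-ℝ frame: the (C1) POINTWISE COERCIVITY DATUM of the centre of record is a KERNEL FACT — hypothesis-ledger row #3 discharged
# by hand inequalities (no interval engine), and the word with rows #3, #8a discharged

HONEST FRAMING (cell ns-blowup GROUP B / zone Z3, cases Z3-SR-CERT + Z3-SR-SPEC; 1-D MODEL certificate (viscous gCLM/OSW sheet on the line at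
`(a, c_l, ε) = (1/5, 1/2, 1)`); computer-assisted frame; not Euler/NS; «violates: none — MODEL»).  The end-to-end MODEL theorem
`SheetRCertifiedProfileOfRecord.certifiedProfile_word_ofRecord` carries NINE interval-arithmetic sentences of record about DEFINED objects
(HYPOTHESIS-LEDGER v2, rows #3–#8, #10–#12).  Row #3 is the (C1) pointwise datum of the Newton–Kantorovich row («`κ_λ − ¼ ≥ 0` on `[0, π)`»):

  `hC1 : ∀ ξ, (64 + ξ²)/2 + 1 + ξ²/2 + (1/5)·ξ·𝒰Ω̄(ξ) + (1/10)(64 + ξ²)·HΩ̄(ξ) ≤ (64 + ξ²)·V(ξ)`,  `V = 1 − HΩ̄ + 4·64/(64 + ξ²)`.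

With the closed forms of the tree (`hilbertTransform_centreOfRecord`, `integral_hilbertTransform_centreOfRecord`, `potential_centreOfRecord`;
`θ = 2arctan(ξ/8)`, `w = 64 + ξ²`, `(1 + cos θ)·w = 128`, `ξ = 8 tan(θ/2)`) the margin is

  `RHS − LHS = 287 + (704/5)·Σ d_i cos((i+1)θ) + (8/5)·Σ (d_i/(i+1))·ξ sin((i+1)θ) + (128α₂/π)·(11/10 − (9/10)·ξ·arsinh(ξ/8)/√w)`

(float minimum `≈ 9.01` at `ξ = 0`, i.e. `κ_λ(0) − ¼ ≈ 0.14`; `≥ 30` for `|ξ| ≥ ½`, `≥ 300` for `|ξ| ≥ 4`).  THE STRUCTURE THAT MAKES THIS A HAND PROOF: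
every one of the 767 frame coefficients `d_i` of record is `≤ 0` except a set of total mass `5·10⁻⁵`, so termwise `d_i cos((i+1)θ) ≥ −|d_i|` and
`d_0 cos θ = d_0(1 − 2ξ²/w)`; `|ξ sin((i+1)θ)| ≤ (i+1)·16ξ²/w` (`|sin nθ| ≤ n|sin θ|`, `sin θ = 16ξ/w`); `ξ·arsinh(ξ/8) ≥ 0`, `α₂ < 0`, `π > 3`.  Hence

  `RHS − LHS ≥ 287 − (704/5)·Σ|d_i| + (704/15)·α₂ + (ξ²/w)·(−(1408/5)·d_0 − (128/5)·Σ|d_i|) > 8 > 0`,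

the ONLY data facts being `Σ|d_i| < 1.866` and `−0.4776 < d_0 < −0.4775` (one `decide +kernel` each on the dyadic table of `SheetRCentreOfRecordData`,
pattern of `SheetRCentreOfRecordValue.sumAtEight_lt`).  Contents: §1 the two data facts and their real casts; §2 the three analytic bounds (cosine
part, sine part, far-field part); §3 **`pointwiseDatum_centreOfRecord`** = `hC1` VERBATIM (row #3 KERNEL for the centre of record); §4
**`exists_baseSolutionOperator_ofRecord`** (row #4: THE base solution operator exists, `‖S₀ g‖ ≤ 2‖g‖`, energy-class uniqueness — by
`SheetRCertificateCoercivity.exists_solutionOperator_of_pointwise`) and **`certifiedProfile_word_ofRecord₈`** = the word with rows #3 and #8a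
(cert-1's `SheetRFrameCentreResidual.integrable_weight_residual_sq_centreOfRecord`) DISCHARGED: eight named hypotheses remain (#4 `S₀, hS₀` — kernel
given #3 but still the object rows #5–#7 speak about —, #5 `f, ℓ, Nmat, hN₁, hN₂`, #6 `hKNwB`, #7 `hepsNB`, #8b `hηB`, #10 `hS1`, #11 `hPD`, #12 `hFD`).
No definition, no named fact.  WHAT THIS IS NOT: not NS; no other interval sentence of record is touched; «a kernel coercivity datum is not a
certified profile, and a certified MODEL profile is not an NS blow-up».
-/

noncomputable section

namespace Summit.NavierStokesRegularity.OSWSelfSimilar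
namespace SheetRPointwiseDatumOfRecord

open _root_.MeasureTheory _root_.Set _root_.Filter _root_.Real _root_.Metric Literature.Analysis.Fourier SheetRWeakProfilePV SheetRWeakToStrong
  SheetREnergyClass SheetRWeightedMeasure SheetREnergySpace SheetRLinearisedTests SheetRTestSpace SheetRLinearisedFormBounds
  SheetRSolutionOperator SheetRComplexPivot SheetRAssemblyOperators SheetRCertificateAssembly SheetRGeneratorOddWeak SheetROddClass
  SheetRResolventOddClass SheetREvansOdd SheetRSpectrumWindingLists SheetRSpectrumOddAssembly SheetRSpectrumOddAssemblyReal SheetRWeakEigenReal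
  SheetRPerturbedResolventC SheetRLinearisationPerturbation SheetRTimeShiftModeWeak SheetRTimeShiftModeWeakEigen SheetRCentreReencoding
  SheetRSpectrumStepRule SheetRSpectrumPointCertificate SheetRResolventConj SheetRSpectrumPointAssembly SheetRSpectrumEndToEnd
  SheetRSpectrumPointEndToEnd SheetRCertificateWeakZero SheetRCertificateCoercivity SheetRCertificateAssemblyB SheetRSpectrumCertifiedProfile
  SheetRFrameCentre SheetRCentreOfRecord SheetRCentreOfRecordValue SheetRLiftOfRecord SheetRCayleySubstitution SheetRFrameCentreVelocity
  SheetRFrameCentreResidual SheetRCertifiedProfileOfRecord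
  Literature.Analysis.OperatorTheory CertificateViscousSheetR Matrix Finset
open scoped Topology ENNReal InnerProductSpace ContDiff BigOperators

/-! ### §1 The two data facts (exact rational arithmetic on the dyadic table) -/

/-- **DATA FACT 1 (kernel)**: `Σ_{i<767} |d_{i+1}| < 1.866` (the exact value is `≈ 1.8659404`). [folklore] -/
theorem sumAbsCoeffQ_lt : ((List.range 767).map fun i => |coeffQ i|).sum < (1866 : ℚ) / 1000 := by
  decide +kernel

/-- **DATA FACT 2 (kernel)**: `−0.4776 < d_1 < −0.4775` (`d_1 = −4729715612202432898592763063/2⁹³ ≈ −0.47758`). [folklore] -/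
theorem coeffQ_zero_bounds : -((4776 : ℚ) / 10000) < coeffQ 0 ∧ coeffQ 0 < -((4775 : ℚ) / 10000) := by
  decide +kernel

/-- The real sum of the absolute frame coefficients is the cast of the rational bookkeeping sum. [folklore] -/
theorem sum_abs_centreCoeff_eq_cast :
    (∑ i ∈ Finset.range 767, |centreCoeff i|) = ((((List.range 767).map fun i => |coeffQ i|).sum : ℚ) : ℝ) := by
  have hlist : (List.range 767).map (fun i => |centreCoeff i|) = (List.range 767).map (fun i => (((|coeffQ i| : ℚ)) : ℝ)) := by
    refine List.map_congr_left fun i _ => ?_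
    rw [centreCoeff_eq_cast, Rat.cast_abs]
  rw [sum_range_eq_list_sum, hlist, Rat.cast_list_sum, List.map_map]
  rfl

/-- `Σ_{i<767} |d_{i+1}| < 1.866` over `ℝ`. [folklore] -/
theorem sum_abs_centreCoeff_lt : (∑ i ∈ Finset.range 767, |centreCoeff i|) < 1866 / 1000 := by
  rw [sum_abs_centreCoeff_eq_cast]
  have h := (Rat.cast_lt (K := ℝ)).2 sumAbsCoeffQ_lt
  have e : ((((1866 : ℚ) / 1000 : ℚ)) : ℝ) = 1866 / 1000 := by push_cast; ring
  rwa [e] at h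

/-- `−0.4776 < d_1 < −0.4775` over `ℝ`. [folklore] -/
theorem centreCoeff_zero_bounds : -(4776 / 10000 : ℝ) < centreCoeff 0 ∧ centreCoeff 0 < -(4775 / 10000) := by
  rw [centreCoeff_eq_cast]
  obtain ⟨h1, h2⟩ := coeffQ_zero_bounds
  have h1' := (Rat.cast_lt (K := ℝ)).2 h1
  have h2' := (Rat.cast_lt (K := ℝ)).2 h2
  have e1 : (((-((4776 : ℚ) / 10000) : ℚ)) : ℝ) = -(4776 / 10000) := by push_cast; ring
  have e2 : (((-((4775 : ℚ) / 10000) : ℚ)) : ℝ) = -(4775 / 10000) := by push_cast; ring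
  rw [e1] at h1'
  rw [e2] at h2'
  exact ⟨h1', h2'⟩

/-- `−0.341 < α₂ < 0`. [folklore] -/
theorem centreAlpha2_bounds : -(341 / 1000 : ℝ) < centreAlpha2 ∧ centreAlpha2 < 0 := by
  refine ⟨?_, centreAlpha2_neg⟩
  rw [centreAlpha2]
  norm_num

/-! ### §2 The three analytic bounds -/

/-- **Cosine part.** With `(1 + cos θ)·(64 + ξ²) = 128` and `cos θ = 1 − 2ξ²/(64 + ξ²)`:
`(64 + ξ²)·Σ d_i(1 + cos θ)cos((i+1)θ) ≥ 128·(d_0(1 − 2ξ²/(64 + ξ²)) + |d_0| − Σ|d_i|)` (termwise `d cos ≥ −|d|` for `i ≥ 1`). [folklore] -/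
theorem weight_mul_cosSum_ge (ξ : ℝ) :
    128 * (centreCoeff 0 * (1 - 2 * (ξ ^ 2 / ((8:ℝ) ^ 2 + ξ ^ 2))) + |centreCoeff 0| - ∑ i ∈ Finset.range 767, |centreCoeff i|)
      ≤ ((8:ℝ) ^ 2 + ξ ^ 2) * ∑ i ∈ Finset.range 767,
          centreCoeff i * ((1 + cos (2 * arctan (ξ / 8))) * cos ((i + 1 : ℕ) * (2 * arctan (ξ / 8)))) := by
  have h8 : (8:ℝ) ≠ 0 := by norm_num
  have hw : (8:ℝ) ^ 2 + ξ ^ 2 ≠ 0 := by positivity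
  set θ := 2 * arctan (ξ / 8) with hθ
  -- `(64 + ξ²)(1 + cos θ) = 128`
  have hkey : ((8:ℝ) ^ 2 + ξ ^ 2) * ∑ i ∈ Finset.range 767, centreCoeff i * ((1 + cos θ) * cos ((i + 1 : ℕ) * θ))
      = 128 * ∑ i ∈ Finset.range 767, centreCoeff i * cos ((i + 1 : ℕ) * θ) := by
    rw [hθ, one_add_cos_cayleyAngle h8 ξ, Finset.mul_sum, Finset.mul_sum]
    refine Finset.sum_congr rfl fun i _ => ?_
    field_simp
    ring
  rw [hkey]
  refine mul_le_mul_of_nonneg_left ?_ (by norm_num)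
  -- split off `i = 0`
  rw [Finset.sum_range_succ' (fun i => centreCoeff i * cos ((i + 1 : ℕ) * θ)), Finset.sum_range_succ' (fun i => |centreCoeff i|)]
  have hcos : cos (((0 : ℕ) + 1 : ℕ) * θ) = 1 - 2 * (ξ ^ 2 / ((8:ℝ) ^ 2 + ξ ^ 2)) := by
    rw [show (((0 : ℕ) + 1 : ℕ) : ℝ) * θ = θ by push_cast; ring, hθ, cos_cayleyAngle h8 ξ]
    field_simp
    ring
  have htail : -(∑ i ∈ Finset.range 766, |centreCoeff (i + 1)|)
      ≤ ∑ i ∈ Finset.range 766, centreCoeff (i + 1) * cos (((i + 1 : ℕ) + 1 : ℕ) * θ) := by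
    rw [← Finset.sum_neg_distrib]
    refine Finset.sum_le_sum fun i _ => ?_
    refine neg_le_of_abs_le ?_
    rw [abs_mul]
    exact (mul_le_mul_of_nonneg_left (abs_cos_le_one _) (abs_nonneg _)).trans_eq (mul_one _)
  rw [hcos]
  linarith

/-- **Sine part.** With `sin θ = 16ξ/(64 + ξ²)` and `|sin((i+1)θ)| ≤ (i+1)|sin θ|`:
`|ξ·Σ d_i(8/(i+1))sin((i+1)θ)| ≤ 128·(ξ²/(64 + ξ²))·Σ|d_i|`. [folklore] -/
theorem abs_mul_sinSum_le (ξ : ℝ) :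
    |ξ * ∑ i ∈ Finset.range 767, centreCoeff i * ((8:ℝ) / (i + 1 : ℕ) * sin ((i + 1 : ℕ) * (2 * arctan (ξ / 8))))|
      ≤ 128 * (ξ ^ 2 / ((8:ℝ) ^ 2 + ξ ^ 2)) * ∑ i ∈ Finset.range 767, |centreCoeff i| := by
  have h8 : (8:ℝ) ≠ 0 := by norm_num
  have hw : (0:ℝ) < (8:ℝ) ^ 2 + ξ ^ 2 := by positivity
  set θ := 2 * arctan (ξ / 8) with hθ
  have hsin : |sin θ| = 16 * |ξ| / ((8:ℝ) ^ 2 + ξ ^ 2) := by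
    rw [hθ, sin_cayleyAngle h8 ξ, abs_div, abs_of_pos hw, abs_mul, abs_of_pos (by norm_num : (0:ℝ) < 2 * 8)]
    ring
  rw [Finset.mul_sum, Finset.mul_sum]
  refine (Finset.abs_sum_le_sum_abs _ _).trans (Finset.sum_le_sum fun i _ => ?_)
  have hi : (0:ℝ) < (i + 1 : ℕ) := by positivity
  have hs : |sin ((i + 1 : ℕ) * θ)| ≤ (i + 1 : ℕ) * |sin θ| := Literature.Analysis.SpecialFunctions.abs_sin_nat_mul_le (i + 1) θ
  rw [hsin] at hs
  have h1 : |ξ * (centreCoeff i * ((8:ℝ) / (i + 1 : ℕ) * sin ((i + 1 : ℕ) * θ)))|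
      = |centreCoeff i| * ((8:ℝ) / (i + 1 : ℕ)) * (|ξ| * |sin ((i + 1 : ℕ) * θ)|) := by
    rw [abs_mul, abs_mul, abs_mul, abs_of_pos (div_pos (by norm_num) hi)]
    ring
  rw [h1]
  have h2 : |ξ| * |sin ((i + 1 : ℕ) * θ)| ≤ |ξ| * ((i + 1 : ℕ) * (16 * |ξ| / ((8:ℝ) ^ 2 + ξ ^ 2))) :=
    mul_le_mul_of_nonneg_left hs (abs_nonneg ξ)
  calc |centreCoeff i| * ((8:ℝ) / (i + 1 : ℕ)) * (|ξ| * |sin ((i + 1 : ℕ) * θ)|)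
      ≤ |centreCoeff i| * ((8:ℝ) / (i + 1 : ℕ)) * (|ξ| * ((i + 1 : ℕ) * (16 * |ξ| / ((8:ℝ) ^ 2 + ξ ^ 2)))) :=
        mul_le_mul_of_nonneg_left h2 (by positivity)
    _ = |centreCoeff i| * ((8:ℝ) / (i + 1 : ℕ) * (i + 1 : ℕ)) * (16 * (|ξ| * |ξ|) / ((8:ℝ) ^ 2 + ξ ^ 2)) := by ring
    _ = 128 * (ξ ^ 2 / ((8:ℝ) ^ 2 + ξ ^ 2)) * |centreCoeff i| := by
        rw [div_mul_cancel₀ _ hi.ne', abs_mul_abs_self, ← pow_two]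
        ring

/-- **Far-field part.** The `α₂·64·T₂` contributions to `RHS − LHS` total `(128α₂/π)(11/10 − (9/10)·ξ·arsinh(ξ/8)/√(64 + ξ²))`, which is
`≥ (704/5)·α₂/3` because `α₂ < 0`, `ξ·arsinh(ξ/8) ≥ 0` and `π > 3`. [folklore] -/
theorem farField_ge (ξ : ℝ) :
    (704 / 5 : ℝ) * centreAlpha2 / 3
      ≤ -(11 / 10) * (((8:ℝ) ^ 2 + ξ ^ 2) * (centreAlpha2 * ((8:ℝ) ^ 2 * (2 / π * (ξ * Real.arsinh (ξ / 8)
            / (((8:ℝ) ^ 2 + ξ ^ 2) * √((8:ℝ) ^ 2 + ξ ^ 2)) - ((8:ℝ) ^ 2 + ξ ^ 2)⁻¹)))))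
        - 1 / 5 * (ξ * (centreAlpha2 * ((8:ℝ) ^ 2 * -(2 / π * Real.arsinh (ξ / 8) / √((8:ℝ) ^ 2 + ξ ^ 2))))) := by
  have hw : (0:ℝ) < (8:ℝ) ^ 2 + ξ ^ 2 := by positivity
  have hsq : (0:ℝ) < √((8:ℝ) ^ 2 + ξ ^ 2) := Real.sqrt_pos.2 hw
  have hπ : (0:ℝ) < π := pi_pos
  have hα : centreAlpha2 < 0 := centreAlpha2_neg
  -- `ξ·arsinh(ξ/8) ≥ 0`
  have hρ : 0 ≤ ξ * Real.arsinh (ξ / 8) := by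
    rcases le_or_gt 0 ξ with h | h
    · exact mul_nonneg h (Real.arsinh_nonneg_iff.2 (by positivity))
    · exact mul_nonneg_of_nonpos_of_nonpos h.le (Real.arsinh_nonpos_iff.2 (by linarith))
  set ρ := ξ * Real.arsinh (ξ / 8) / √((8:ℝ) ^ 2 + ξ ^ 2) with hρdef
  have hρ0 : 0 ≤ ρ := div_nonneg hρ hsq.le
  have e : -(11 / 10) * (((8:ℝ) ^ 2 + ξ ^ 2) * (centreAlpha2 * ((8:ℝ) ^ 2 * (2 / π * (ξ * Real.arsinh (ξ / 8)
            / (((8:ℝ) ^ 2 + ξ ^ 2) * √((8:ℝ) ^ 2 + ξ ^ 2)) - ((8:ℝ) ^ 2 + ξ ^ 2)⁻¹)))))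
        - 1 / 5 * (ξ * (centreAlpha2 * ((8:ℝ) ^ 2 * -(2 / π * Real.arsinh (ξ / 8) / √((8:ℝ) ^ 2 + ξ ^ 2)))))
      = centreAlpha2 * (704 / 5 - 576 / 5 * ρ) / π := by
    rw [hρdef]
    field_simp
    ring
  rw [e, le_div_iff₀ hπ]
  have h3 : 3 * -centreAlpha2 ≤ π * -centreAlpha2 := mul_le_mul_of_nonneg_right pi_gt_three.le (by linarith)
  have h4 : 0 ≤ -centreAlpha2 * ρ := mul_nonneg (by linarith) hρ0
  nlinarith [h3, h4]

/-! ### §3 HYPOTHESIS-LEDGER ROW #3: the (C1) pointwise datum of the centre of record -/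

/-- **THE (C1) POINTWISE COERCIVITY DATUM OF THE CENTRE OF RECORD (kernel; hypothesis-ledger row #3).**  For every `ξ`,
`(64 + ξ²)/2 + 1 + ξ²/2 + (1/5)ξ·∫₀^ξHΩ̄ + (1/10)(64 + ξ²)HΩ̄(ξ) ≤ (64 + ξ²)·potential 8 4 Ω̄ ξ` — the hypothesis `hC1` of
`certifiedProfile_word_ofRecord` / `modelBlowup_of_pointwise_certificate`, VERBATIM, for `Ω̄ = centreOfRecord`.  MODEL statement; not NS. [folklore] -/
theorem pointwiseDatum_centreOfRecord (ξ : ℝ) :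
    ((8:ℝ) ^ 2 + ξ ^ 2) / 2 + 1 + ξ ^ 2 / 2 + 1 / 5 * ξ * (∫ s in (0 : ℝ)..ξ, hilbertTransform centreOfRecord s)
      + (1 / 5) / 2 * ((8:ℝ) ^ 2 + ξ ^ 2) * hilbertTransform centreOfRecord ξ ≤ ((8:ℝ) ^ 2 + ξ ^ 2) * potential 8 4 centreOfRecord ξ := by
  have hw : (8:ℝ) ^ 2 + ξ ^ 2 ≠ 0 := by positivity
  have hA := weight_mul_cosSum_ge ξ
  have hB := (abs_le.1 (abs_mul_sinSum_le ξ)).1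
  have hC := farField_ge ξ
  have hS := sum_abs_centreCoeff_lt
  have hd := centreCoeff_zero_bounds
  have hα := centreAlpha2_bounds
  have hv : 0 ≤ ξ ^ 2 / ((8:ℝ) ^ 2 + ξ ^ 2) := by positivity
  have habs : -|centreCoeff 0| ≤ centreCoeff 0 := neg_abs_le _
  have hp : 0 ≤ (-(1408 / 5) * centreCoeff 0 - 128 / 5 * ∑ i ∈ Finset.range 767, |centreCoeff i|) * (ξ ^ 2 / ((8:ℝ) ^ 2 + ξ ^ 2)) :=
    mul_nonneg (by linarith) hv
  have h64 : ((8:ℝ) ^ 2 + ξ ^ 2) * ((8:ℝ) ^ 2 / ((8:ℝ) ^ 2 + ξ ^ 2)) = (8:ℝ) ^ 2 := mul_div_cancel₀ _ hw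
  rw [potential_centreOfRecord, hilbertTransform_centreOfRecord, integral_hilbertTransform_centreOfRecord]
  set SC := ∑ i ∈ Finset.range 767, centreCoeff i * ((1 + cos (2 * arctan (ξ / 8))) * cos ((i + 1 : ℕ) * (2 * arctan (ξ / 8))))
    with hSC
  set SS := ∑ i ∈ Finset.range 767, centreCoeff i * ((8:ℝ) / (i + 1 : ℕ) * sin ((i + 1 : ℕ) * (2 * arctan (ξ / 8)))) with hSS
  set HT := 2 / π * (ξ * Real.arsinh (ξ / 8) / (((8:ℝ) ^ 2 + ξ ^ 2) * √((8:ℝ) ^ 2 + ξ ^ 2)) - ((8:ℝ) ^ 2 + ξ ^ 2)⁻¹) with hHT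
  set UT := 2 / π * Real.arsinh (ξ / 8) / √((8:ℝ) ^ 2 + ξ ^ 2) with hUT
  set SA := ∑ i ∈ Finset.range 767, |centreCoeff i| with hSA
  set v := ξ ^ 2 / ((8:ℝ) ^ 2 + ξ ^ 2) with hvdef
  set q := (8:ℝ) ^ 2 / ((8:ℝ) ^ 2 + ξ ^ 2) with hqdef
  linarith [hA, hB, hC, hS, hd.1, hd.2, hα.1, hα.2, hv, habs, hp, h64]

/-! ### §4 Row #4 and the word with rows #3, #8a discharged -/

/-- **ROW #4 (kernel): THE BASE SOLUTION OPERATOR OF RECORD EXISTS.**  There is a bounded linear `S₀ : W 8 →L Esp 8` solving the weak equation of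
`B_λ` at the centre of record for every right-hand side `g`, with `‖S₀ g‖ ≤ 2‖g‖`, and energy-class weak solutions of that equation (any right-hand
side) are unique — `exists_solutionOperator_of_pointwise` fed with `pointwiseDatum_centreOfRecord`.  MODEL statement; not NS. [folklore] -/
theorem exists_baseSolutionOperator_ofRecord :
    ∃ S₀ : W 8 →L[ℝ] Esp 8 eight_pos,
      (∀ (g : W 8) (v v₁ : ℝ → ℝ), IsCompactTest v v₁ →
        linForm 8 (drift (1 / 5) centreOfRecord) (potential 8 4 centreOfRecord) (prim (der (S₀ g))) (der (S₀ g)) v v₁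
          = ∫ y, ((8:ℝ) ^ 2 + y ^ 2) * ((g : ℝ → ℝ) y * v y)) ∧
      (∀ g : W 8, ‖S₀ g‖ ≤ 2 * ‖g‖) ∧
      ∀ (rhs : (ℝ → ℝ) → (ℝ → ℝ) → ℝ) (p q : Esp 8 eight_pos),
        (∀ v v₁ : ℝ → ℝ, IsCompactTest v v₁ →
          linForm 8 (drift (1 / 5) centreOfRecord) (potential 8 4 centreOfRecord) (prim (der p)) (der p) v v₁ = rhs v v₁) →
        (∀ v v₁ : ℝ → ℝ, IsCompactTest v v₁ →
          linForm 8 (drift (1 / 5) centreOfRecord) (potential 8 4 centreOfRecord) (prim (der q)) (der q) v v₁ = rhs v v₁) → p = q :=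
  exists_solutionOperator_of_pointwise eight_pos 4 (1 / 5) isCentre_centreOfRecord pointwiseDatum_centreOfRecord

/-- **EXISTENCE ∘ SPECTRUM FOR THE CENTRE AND LIFT OF RECORD, rows #3 and #8a DISCHARGED.**  `certifiedProfile_word_ofRecord` with the (C1)
pointwise datum supplied by `pointwiseDatum_centreOfRecord` and the residual integrability `hG` by
`SheetRFrameCentreResidual.integrable_weight_residual_sq_centreOfRecord`; EIGHT named hypotheses remain, all interval sentences of record about
defined objects or about THE base solution operator `S₀` (#4 `S₀, hS₀`; #5 `f, ℓ, Nmat, hN₁, hN₂`; #6 `hKNwB`; #7 `hepsNB`; #8b `hηB`; #10 `hS1`;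
#11 `hPD`; #12 `hFD`).  Conclusion verbatim.  MODEL statement; not NS. [folklore] -/
theorem certifiedProfile_word_ofRecord₈
    (S₀ : W 8 →L[ℝ] Esp 8 eight_pos)
    (hS₀ : ∀ (g : W 8) (v v₁ : ℝ → ℝ), IsCompactTest v v₁ →
      linForm 8 (drift (1 / 5) centreOfRecord) (potential 8 4 centreOfRecord) (prim (der (S₀ g))) (der (S₀ g)) v v₁
        = ∫ y, ((8:ℝ) ^ 2 + y ^ 2) * ((g : ℝ → ℝ) y * v y))
    {n : ℕ} (f : Fin n → W 8) (ℓ : Fin n → Esp 8 eight_pos →L[ℝ] ℝ) (Nmat : Matrix (Fin n) (Fin n) ℝ)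
    (hN₁ : (1 - capMatrix (fun i => S₀ (f i)) ℓ) * Nmat = 1) (hN₂ : Nmat * (1 - capMatrix (fun i => S₀ (f i)) ℓ) = 1)
    (hKNwB : ∀ g : W 8, ‖capInverse (fun i => S₀ (f i)) ℓ Nmat (S₀ g)‖ ≤ (KNwB : ℝ) * ‖g‖)
    (hepsNB : ∀ u : Esp 8 eight_pos, ‖PopC eight_pos 4 (1 / 5) isCentre_centreOfRecord u - ∑ i, ℓ i u • f i‖ ≤ (epsNBR : ℝ) * ‖u‖)
    (hηB : Real.sqrt (∫ y, ((8:ℝ) ^ 2 + y ^ 2) * (centreOfRecord y + 1 / 2 * y * centreOfRecordDeriv y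
      + 1 / 5 * (∫ s in (0 : ℝ)..y, hilbertTransform centreOfRecord s) * centreOfRecordDeriv y
      - hilbertTransform centreOfRecord y * centreOfRecord y - deriv centreOfRecordDeriv y) ^ 2) ≤ (etaB2 : ℝ))
    {D₀ D₁ V₀ : ℝ}
    (hS1 : GardingDataKC 8 eight_pos (drift (1 / 5) centreOfRecord) (potential 8 4 centreOfRecord)
      (-PopC eight_pos 4 (1 / 5) isCentre_centreOfRecord + ((4 : ℝ) • ((innerSL ℝ liftOfRecord).comp (ιE eight_pos))).smulRight liftOfRecord)
      D₀ D₁ V₀ (1 / 5) (3 / 20))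
    (hPD : PointData (resolventKC eight_pos _ hS1) (ofRealW 8 liftOfRecord) (ofRealW 8 liftOfRecord) 4
      (evansOdd eight_pos _ hS1 ((innerSL ℂ (ofRealW 8 liftOfRecord)).comp (Wcodd 8).subtypeL) (realOdd liftOfRecord liftOfRecord_mem_Wodd) 4))
    (hFD : MixedFarDatum (resolventKC eight_pos _ hS1) (ofRealW 8 liftOfRecord) (ofRealW 8 liftOfRecord) 1 ((3593635617 : ℝ) / 5000000000)
      ((331182857 : ℝ) / 250000000) ((802337581 : ℝ) / 500000000) ((1710547133 : ℝ) / 1000000000)) :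
    ∃ δ : Esp 8 eight_pos, δ ∈ closedBall (0 : Esp 8 eight_pos) (rEBR2 : ℝ) ∧
      (∀ v v₁ : ℝ → ℝ, IsCompactTest v v₁ →
        linForm 8 (drift (1 / 5) centreOfRecord) (potential 8 4 centreOfRecord) (prim (der δ)) (der δ) v v₁ =
          ∫ y, ((8:ℝ) ^ 2 + y ^ 2) * ((PopFun 8 4 (1 / 5) centreOfRecord centreOfRecordDeriv δ y
            - (centreOfRecord y + 1 / 2 * y * centreOfRecordDeriv y
              + 1 / 5 * (∫ s in (0 : ℝ)..y, hilbertTransform centreOfRecord s) * centreOfRecordDeriv y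
              - hilbertTransform centreOfRecord y * centreOfRecord y - deriv centreOfRecordDeriv y)
            - QFun 8 (1 / 5) δ δ y) * v y)) ∧
      (∀ δ' ∈ closedBall (0 : Esp 8 eight_pos) (rEBR2 : ℝ),
        (∀ v v₁ : ℝ → ℝ, IsCompactTest v v₁ →
          linForm 8 (drift (1 / 5) centreOfRecord) (potential 8 4 centreOfRecord) (prim (der δ')) (der δ') v v₁ =
            ∫ y, ((8:ℝ) ^ 2 + y ^ 2) * ((PopFun 8 4 (1 / 5) centreOfRecord centreOfRecordDeriv δ' y
              - (centreOfRecord y + 1 / 2 * y * centreOfRecordDeriv y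
                + 1 / 5 * (∫ s in (0 : ℝ)..y, hilbertTransform centreOfRecord s) * centreOfRecordDeriv y
                - hilbertTransform centreOfRecord y * centreOfRecord y - deriv centreOfRecordDeriv y)
              - QFun 8 (1 / 5) δ' δ' y) * v y)) → δ' = δ) ∧
      ∃ (Ωs₁ : ℝ → ℝ) (Hs : ℝ) (hcs : IsCentre 8 (fun y => centreOfRecord y + prim (der δ) y) Ωs₁ Hs),
        {σ : ℂ | ra < σ.re ∧ ∃ w : Wcodd 8, w ≠ 0 ∧
          IsWeakEigen eight_pos (-PopC eight_pos 4 (1 / 5) hcs + ((4 : ℝ) • ((innerSL ℝ liftOfRecord).comp (ιE eight_pos))).smulRight liftOfRecord)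
            (drift (1 / 5) (fun y => centreOfRecord y + prim (der δ) y)) (potential 8 4 (fun y => centreOfRecord y + prim (der δ) y))
            ((innerSL ℂ (ofRealW 8 liftOfRecord)).comp (Wcodd 8).subtypeL) (realOdd liftOfRecord liftOfRecord_mem_Wodd) 4 σ w} = {1} :=
  certifiedProfile_word_ofRecord pointwiseDatum_centreOfRecord S₀ hS₀ f ℓ Nmat hN₁ hN₂ hKNwB hepsNB
    integrable_weight_residual_sq_centreOfRecord hηB hS1 hPD hFD

end SheetRPointwiseDatumOfRecord
end Summit.NavierStokesRegularity.OSWSelfSimilar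

end
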